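import Literature.Probability.Percolation.SlabCircuitGlueFactOne
import Literature.Probability.Percolation.SlabGluingHighProb
import HarnessLib

/-!
# Newman–Tassion–Wu 2017, Theorem 3.8 / CPAM Theorem 3.10 — FACT 2 and the circuit gluing lemma in the
# HIGH-PROBABILITY regime

Topic: `Literature/Probability/Percolation`.  Sixth file of the circuit gluing layer.  Fact 2 (NTW (3.8):
"`P[Γ₁ ≈ Γ₂, Γ₁ ↮ Γ₂, |U| ≥ t] ≤ (C₂/t) P[Γ₁ ⟷ Γ₂]` using a map `ω ↦ {ω^{(z)} : z ∈ U(ω)}`") from the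
located vertical gadgets of `SlabCircuitGlueSurgery.lean` — one column each, so that the images at
distinct entry cells are distinct (their recovery statistics lie in distinct columns) and every preimage
of an image agrees with it off the `≤ 5k+4` lattice pairs of the column of its statistic — and then the
tree's `exists_delta_of_facts` (the function `h₁` of Theorem 3.7) applied to Facts 1–2:

* `CircGlue.fact2` — `P_p[𝒳 ∩ {|U| ≥ t}] ≤ (λ^{5k+4}/t) · P_p[C̄ ⟷ Γ]`.
* **`circuitGlue_highProb`** — for every `k`, `ε > 0`, `η > 0` there is `δ > 0` such that for every
  `CircGlue k` datum (ANY finite world containing the annulus, ANY source off the box of the annulus)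
  and every `p ∈ [ε, 1-ε]`: `P_p[C̄ ⟷^{W̄} col(Γ)] ≥ 1 - δ ⟹ P_p[C̄ ⟷^{W̄} Γ] ≥ 1 - η`.  This is the
  circuit gluing lemma (arXiv Theorem 3.8 / CPAM Theorem 3.10, one step) with `δ` uniform in the
  geometry — the input of Lemma 3.11 ((H38)) and of Theorem 3.17 ((H317)).

## Sources

* C. M. Newman, V. Tassion, W. Wu, *Critical percolation and the minimal spanning tree in slabs*,
  Comm. Pure Appl. Math. 70 (2017) = arXiv:1512.09107: §3.2, proof of Theorem 3.7/3.9 (Facts 1–2, the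
  function h₁) and of Theorem 3.8/3.10, (3.5)–(3.8) [NewmanTassionWu2017].
-/

noncomputable section

namespace Literature.Probability.Percolation

open MeasureTheory LatticeModels SimpleGraph Finset

namespace NTW17

namespace CircGlue

variable {k : ℕ}

/-- **FACT 2 for the circuit gluing lemma**: for every `CircGlue` datum, `0 < p < 1` and `t ≥ 1`,
`P_p[𝒳 ∩ {|U| ≥ t}] ≤ (λ^{5k+4}/t) · P_p[C̄ ⟷^{W̄} Γ]`, `λ = 2/min{p,1-p}`: the multi-valued map
`ω ↦ {ω^{(y)} : y ∈ U(ω)}` (vertical gadgets at all entry cells) has at least `t` values, pairwise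
distinct (recovery statistics in distinct columns), and every preimage of a value agrees with it off the
`≤ 5k+4` lattice pairs of one column; Lemma 3.5. [cite: NewmanTassionWu2017, §3.2 (CPAM Theorem 3.10, (3.8); proof of Theorem 3.7, Fact 2)] -/
theorem fact2 (D : CircGlue k) (p : unitInterval) (hp0 : 0 < (p : ℝ)) (hp1 : (p : ℝ) < 1) (t : ℕ) (ht : 1 ≤ t) :
    (bondPercolation (slabGraph 3 k) p).real (D.evX ∩ {ω | t ≤ (D.Uent ω).ncard}) ≤
      (2 / min (p : ℝ) (1 - p)) ^ (5 * k + 4) / t * (bondPercolation (slabGraph 3 k) p).real D.evGlued := by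
  classical
  set P := bondPercolation (slabGraph 3 k) p with hP
  -- the gadgets
  let gad : ∀ (ω : BondConfig (slab 3 k)) (_h : ω ⊆ (slabGraph 3 k).edgeSet ∧ ω ∈ D.evX) (y : ℤ × ℤ), y ∈ D.Uent ω →
      BondConfig (slab 3 k) := fun ω h y hy => Classical.choose (exists_vGadget h.2 hy)
  have hgad' : ∀ ω h y hy, VGadget D ω (gad ω h y hy) y := fun ω h y hy => Classical.choose_spec (exists_vGadget h.2 hy)
  -- the window
  have hWfin : (slabLift k D.W).Finite := slabLift_finite k D.hWfin
  set K' : Finset (Sym2 (slab 3 k)) := (finite_sym2 hWfin).toFinset with hK'def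
  have hK'coe : (↑K' : Set (Sym2 (slab 3 k))) = (slabLift k D.W).sym2 := Set.Finite.coe_toFinset _
  set Kfin : Finset (Sym2 (slab 3 k)) := K'.filter (· ∈ (slabGraph 3 k).edgeSet) with hKfin
  have hK : ∀ e, e ∈ Kfin ↔ e ∈ K' ∧ e ∈ (slabGraph 3 k).edgeSet := fun e => Finset.mem_filter
  have hKE : ∀ e ∈ Kfin, e ∈ (slabGraph 3 k).edgeSet := fun e he => ((hK e).1 he).2
  have hagree : ∀ ω ω' : BondConfig (slab 3 k), ω ∩ ↑K' = ω' ∩ ↑K' →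
      ∀ e ∈ (slabLift k D.W).sym2, (e ∈ ω ↔ e ∈ ω') := by
    intro ω ω' heq e he
    rw [← hK'coe] at he
    have := Set.ext_iff.1 heq e
    simp only [Set.mem_inter_iff, he, and_true] at this
    exact this
  obtain ⟨hdX, hdG, -⟩ := determinedBy_events (D := D)
  have hA : DeterminedBy (D.evX ∩ {ω | t ≤ (D.Uent ω).ncard}) ↑K' := by
    rw [determinedBy_iff]
    intro ω ω' heq
    simp only [Set.mem_inter_iff, Set.mem_setOf_eq]
    rw [(determinedBy_iff _ _).1 hdX ω ω' (by rw [hK'coe] at heq; exact heq), Uent_congr (hagree ω ω' heq)]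
  have hB : DeterminedBy D.evGlued ↑K' := by rw [hK'coe]; exact hdG
  -- lattice configurations inside the window
  have hlat : ∀ S : Finset (Sym2 (slab 3 k)), S ⊆ Kfin →
      (↑S : Set (Sym2 (slab 3 k))) ⊆ (slabGraph 3 k).edgeSet := fun S hS e he => hKE e (hS he)
  have hnewK : ∀ (S : Finset (Sym2 (slab 3 k))) (hS : S ⊆ Kfin) (hSX : (↑S : BondConfig (slab 3 k)) ∈ D.evX)
      (y : ℤ × ℤ) (hy : y ∈ D.Uent ↑S), gad ↑S ⟨hlat S hS, hSX⟩ y hy ⊆ ↑Kfin := by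
    intro S hS hSX y hy e he
    rcases (hgad' (↑S) ⟨hlat S hS, hSX⟩ y hy).window e he with h | ⟨h1, h2⟩
    · exact hS h
    · rw [Finset.mem_coe, hK]
      exact ⟨by rw [← Finset.mem_coe, hK'coe]; exact h2, h1⟩
  have hcoe : ∀ (S : Finset (Sym2 (slab 3 k))) (hS : S ⊆ Kfin) (hSX : (↑S : BondConfig (slab 3 k)) ∈ D.evX)
      (y : ℤ × ℤ) (hy : y ∈ D.Uent ↑S),
      (↑(Kfin.filter (· ∈ gad ↑S ⟨hlat S hS, hSX⟩ y hy)) : Set (Sym2 (slab 3 k))) = gad ↑S ⟨hlat S hS, hSX⟩ y hy := by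
    intro S hS hSX y hy
    ext e
    simp only [Finset.coe_filter, Set.mem_setOf_eq, and_iff_right_iff_imp]
    exact fun he => hnewK S hS hSX y hy he
  -- the multi-valued map
  let Φ : Finset (Sym2 (slab 3 k)) → Finset (Finset (Sym2 (slab 3 k))) := fun S =>
    if h : (↑S : Set (Sym2 (slab 3 k))) ⊆ (slabGraph 3 k).edgeSet ∧ (↑S : BondConfig (slab 3 k)) ∈ D.evX then
      (Uent_finite (D := D) (↑S : BondConfig (slab 3 k))).toFinset.attach.image fun y =>
        Kfin.filter (· ∈ gad ↑S h y.1 ((Set.Finite.mem_toFinset _).1 y.2))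
    else ∅
  have hΦ_of : ∀ (S : Finset (Sym2 (slab 3 k)))
      (h : (↑S : Set (Sym2 (slab 3 k))) ⊆ (slabGraph 3 k).edgeSet ∧ (↑S : BondConfig (slab 3 k)) ∈ D.evX),
      Φ S = (Uent_finite (D := D) (↑S : BondConfig (slab 3 k))).toFinset.attach.image fun y =>
        Kfin.filter (· ∈ gad ↑S h y.1 ((Set.Finite.mem_toFinset _).1 y.2)) := fun S h => dif_pos h
  set lam : ℝ := 2 / min (p : ℝ) (1 - p) with hlam
  set s : ℕ := (5 * k + 4) * (2 * (2 * 0) + 1) ^ 2 with hs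
  have hs' : s = 5 * k + 4 := by rw [hs]; ring
  have ht' : (0 : ℝ) < t := by exact_mod_cast ht
  -- the window of one column
  let box : slab 3 k → Finset (Sym2 (slab 3 k)) := fun q₀ =>
    Kfin.filter fun e => ∃ u ∈ e, planar k u ∈ (sqBox_finite (planar k q₀) (2 * 0)).toFinset
  have hbox_card : ∀ q₀, (box q₀).card ≤ s := by
    intro q₀
    refine (card_filter_colEdges_le k Kfin hKE _).trans ?_
    have := card_toFinset_sqBox_le (planar k q₀) (2 * 0)
    rw [hs]; exact Nat.mul_le_mul_left _ this
  have hbox_agree : ∀ (S S' : Finset (Sym2 (slab 3 k))) (q₀ : slab 3 k) (y : ℤ × ℤ),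
      S ⊆ Kfin → S' ⊆ Kfin → planar k q₀ = y →
      (∀ e, e ∉ touch k ({y} : Set (ℤ × ℤ)) → (e ∈ (↑S : BondConfig (slab 3 k)) ↔ e ∈ (↑S' : BondConfig (slab 3 k)))) →
      ∀ e, e ∉ box q₀ → (e ∈ S ↔ e ∈ S') := by
    intro S S' q₀ y hS hS' hq₀ hag e heT
    by_cases heK : e ∈ Kfin
    · have hnt : e ∉ touch k ({y} : Set (ℤ × ℤ)) := by
        rintro ⟨x, hx, hxD⟩
        rw [Set.mem_singleton_iff] at hxD
        refine heT (Finset.mem_filter.2 ⟨heK, x, hx, (Set.Finite.mem_toFinset _).2 ?_⟩)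
        rw [hxD, ← hq₀]; exact mem_sqBox_self _ _
      have := hag e hnt
      simp only [Finset.mem_coe] at this
      exact this
    · constructor
      · intro heS; exact absurd (hS heS) heK
      · intro heS'; exact absurd (hS' heS') heK
  have hmain := lemma7_bond (slabGraph 3 k) p hp0 hp1 K' Kfin hK hA hB s ht' Φ ?_ ?_ ?_
  · rw [hs'] at hmain; exact hmain
  · -- images glue the source to `Γ`
    intro S hS hSA S' hS'
    have h : (↑S : Set (Sym2 (slab 3 k))) ⊆ (slabGraph 3 k).edgeSet ∧ (↑S : BondConfig (slab 3 k)) ∈ D.evX :=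
      ⟨hlat S hS, hSA.1⟩
    rw [hΦ_of S h, Finset.mem_image] at hS'
    obtain ⟨y, -, rfl⟩ := hS'
    refine ⟨Finset.filter_subset _ _, ?_⟩
    have hyU : y.1 ∈ D.Uent ↑S := (Set.Finite.mem_toFinset _).1 y.2
    rw [hcoe S hS h.2 y.1 hyU]
    exact (hgad' (↑S) h y.1 hyU).mem
  · -- at least `t` images
    intro S hS hSA
    have h : (↑S : Set (Sym2 (slab 3 k))) ⊆ (slabGraph 3 k).edgeSet ∧ (↑S : BondConfig (slab 3 k)) ∈ D.evX :=
      ⟨hlat S hS, hSA.1⟩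
    rw [hΦ_of S h]
    have hinj : Set.InjOn (fun y : {y // y ∈ (Uent_finite (D := D) (↑S : BondConfig (slab 3 k))).toFinset} =>
        Kfin.filter (· ∈ gad ↑S h y.1 ((Set.Finite.mem_toFinset _).1 y.2)))
        ↑((Uent_finite (D := D) (↑S : BondConfig (slab 3 k))).toFinset.attach) := by
      rintro ⟨y, hy⟩ - ⟨y', hy'⟩ - heq
      simp only at heq
      apply Subtype.ext
      have hyU : y ∈ D.Uent ↑S := (Set.Finite.mem_toFinset _).1 hy
      have hy'U : y' ∈ D.Uent ↑S := (Set.Finite.mem_toFinset _).1 hy'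
      have heq' : gad ↑S h y hyU = gad ↑S h y' hy'U := by
        rw [← hcoe S hS h.2 y hyU, ← hcoe S hS h.2 y' hy'U, heq]
      obtain ⟨q, hq⟩ := (hgad' ↑S h y hyU).att_nonempty
      have h1 : planar k q ∈ ({y} : Set (ℤ × ℤ)) := by
        have := (hgad' ↑S h y hyU).att_subset hq; rwa [mem_slabLift_iff] at this
      have h2 : planar k q ∈ ({y'} : Set (ℤ × ℤ)) := by
        rw [heq'] at hq
        have := (hgad' ↑S h y' hy'U).att_subset hq; rwa [mem_slabLift_iff] at this
      rw [Set.mem_singleton_iff] at h1 h2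
      exact h1.symm.trans h2
    rw [Finset.card_image_of_injOn hinj, Finset.card_attach]
    have htU : t ≤ (D.Uent (↑S : BondConfig (slab 3 k))).ncard := hSA.2
    rw [Set.ncard_eq_toFinset_card _ (Uent_finite _)] at htU
    exact_mod_cast htU
  · -- recovery window: the column of the statistic
    intro S' hS' _
    set ω' : BondConfig (slab 3 k) := ↑S' with hω'
    set T : Finset (Sym2 (slab 3 k)) := if h : (D.att ω').Nonempty then box h.some else ∅ with hT
    have hTc : T.card ≤ s := by rw [hT]; split_ifs <;> simp [hbox_card]
    refine ⟨T, hTc, ?_⟩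
    intro S hS hSA hmem e heT
    have h : (↑S : Set (Sym2 (slab 3 k))) ⊆ (slabGraph 3 k).edgeSet ∧ (↑S : BondConfig (slab 3 k)) ∈ D.evX :=
      ⟨hlat S hS, hSA.1⟩
    rw [hΦ_of S h, Finset.mem_image] at hmem
    obtain ⟨⟨y, hy⟩, -, hyeq⟩ := hmem
    have hyU : y ∈ D.Uent ↑S := (Set.Finite.mem_toFinset _).1 hy
    have hω'eq : ω' = gad ↑S h y hyU := by rw [hω', ← hyeq, hcoe S hS h.2 y hyU]
    have hg := hgad' ↑S h y hyU
    have hne : (D.att ω').Nonempty := by rw [hω'eq]; exact hg.att_nonempty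
    have hTeq : T = box hne.some := by rw [hT, dif_pos hne]
    have hsubA : D.att ω' ⊆ slabLift k ({y} : Set (ℤ × ℤ)) := by rw [hω'eq]; exact hg.att_subset
    have hq₀ : planar k hne.some = y := by
      have := hsubA hne.some_mem
      rw [mem_slabLift_iff, Set.mem_singleton_iff] at this
      exact this
    have hag' : ∀ e', e' ∉ touch k ({y} : Set (ℤ × ℤ)) →
        (e' ∈ (↑S : BondConfig (slab 3 k)) ↔ e' ∈ (↑S' : BondConfig (slab 3 k))) := by
      intro e' he'
      rw [show ((↑S' : BondConfig (slab 3 k))) = gad ↑S h y hyU from hω' ▸ hω'eq]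
      exact hg.agree e' he'
    exact hbox_agree S S' hne.some y hS hS' hq₀ hag' e (hTeq ▸ heT)

/-- `evCol` is measurable. [cite: NewmanTassionWu2017, §3.2 (CPAM Theorem 3.10)] -/
theorem measurableSet_evCol (D : CircGlue k) : MeasurableSet D.evCol := by
  classical
  have hWfin : (slabLift k D.W).Finite := slabLift_finite k D.hWfin
  obtain ⟨-, -, hdC⟩ := determinedBy_events (D := D)
  have : DeterminedBy D.evCol ↑((finite_sym2 hWfin).toFinset) := by rw [Set.Finite.coe_toFinset]; exact hdC
  exact this.measurableSet_of_finset

end CircGlue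

/-- **THE CIRCUIT GLUING LEMMA, HIGH-PROBABILITY REGIME** (NTW arXiv Theorem 3.8 / CPAM Theorem 3.10, one
gluing step, `δ` uniform in the geometry): for every `k`, `ε > 0` and `η > 0` there is `δ > 0` such that
for every circuit-gluing datum `D : CircGlue k` (annulus `A_{m,n}(c)`, ANY finite world `W ⊇ A_{m,n}(c)`,
ANY source over a planar set `Csupp ⊆ W` disjoint from `B_n(c)`, possibly configuration-dependent off
the box) and every `p ∈ [ε, 1-ε]`:
`P_p[C̄ ⟷^{W̄} col(Γ_min)] ≥ 1 - δ ⟹ P_p[C̄ ⟷^{W̄} Γ_min] ≥ 1 - η`.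
Proof: Facts 1 (`CircGlue.fact1`) and 2 (`CircGlue.fact2`) fed to the function `h₁` of Theorem 3.7
(`exists_delta_of_facts`) at the worst parameter `λ ≤ max 1 (2/ε)`.
[cite: NewmanTassionWu2017, Theorem 3.8 (arXiv) = Theorem 3.10 (CPAM), (3.5)–(3.8) with the first part of the proof of Theorem 3.7] -/
theorem circuitGlue_highProb (k : ℕ) {ε : ℝ} (hε : 0 < ε) {η : ℝ} (hη : 0 < η) :
    ∃ δ : ℝ, 0 < δ ∧ ∀ (D : CircGlue k) (p : unitInterval), ε ≤ (p : ℝ) → (p : ℝ) ≤ 1 - ε →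
      1 - δ ≤ (bondPercolation (slabGraph 3 k) p).real D.evCol →
      1 - η ≤ (bondPercolation (slabGraph 3 k) p).real D.evGlued := by
  set a : ℕ := 5 * k + 4 with ha
  set L : ℝ := max 1 (2 / ε) with hL
  have hL1 : 1 ≤ L := le_max_left _ _
  have hL0 : 0 ≤ L := zero_le_one.trans hL1
  set C₁ : ℝ := L ^ a with hC₁
  set C₂ : ℝ := L ^ a with hC₂
  have hC₁1 : 1 ≤ C₁ := one_le_pow₀ hL1
  have hC₂0 : 0 ≤ C₂ := by positivity
  obtain ⟨t, ht8, δ, hδ, H⟩ := exists_delta_of_facts (C₁ := C₁) (C₂ := C₂) hC₁1 hC₂0 hη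
  refine ⟨δ, hδ, fun D p hpε hp1 hN => ?_⟩
  set P := bondPercolation (slabGraph 3 k) p with hP
  have hp0 : 0 < (p : ℝ) := hε.trans_le hpε
  have hp1' : (p : ℝ) < 1 := by linarith
  have hlam0 : 0 ≤ 2 / min (p : ℝ) (1 - p) := by positivity
  have hlam : 2 / min (p : ℝ) (1 - p) ≤ L := by
    refine le_trans ?_ (le_max_right _ _)
    exact div_le_div_of_nonneg_left (by norm_num) hε (le_min hpε (by linarith))
  have hXeq : D.evCol \ D.evGlued = D.evX := rfl
  -- Fact 1
  have hF1 : P.real ((D.evCol \ D.evGlued) ∩ {ω | (D.Uent ω).ncard ≤ t}) ≤ C₁ ^ t * P.real (D.evCol)ᶜ := by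
    have h1 := CircGlue.fact1 D p hp0 hp1' t
    have hconst : (2 / min (p : ℝ) (1 - p)) ^ ((5 * k + 4) * t) ≤ C₁ ^ t := by
      rw [show (5 * k + 4) * t = a * t by rw [ha], pow_mul, hC₁]
      exact pow_le_pow_left₀ (by positivity) (pow_le_pow_left₀ hlam0 hlam a) t
    rw [hXeq]
    exact h1.trans (mul_le_mul_of_nonneg_right hconst measureReal_nonneg)
  -- Fact 2 at level `t + 1`
  have hF2 : P.real ((D.evCol \ D.evGlued) ∩ {ω | t < (D.Uent ω).ncard}) ≤ C₂ / ((t : ℝ) - 8) * P.real D.evGlued := by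
    have h2 := CircGlue.fact2 D p hp0 hp1' (t + 1) (by omega)
    have hmono : P.real ((D.evCol \ D.evGlued) ∩ {ω | t < (D.Uent ω).ncard}) ≤
        P.real (D.evX ∩ {ω | t + 1 ≤ (D.Uent ω).ncard}) :=
      measureReal_mono (fun ω hω => ⟨hω.1, hω.2⟩) (measure_ne_top _ _)
    have ht8' : (8 : ℝ) < t := by exact_mod_cast ht8
    have hconst : (2 / min (p : ℝ) (1 - p)) ^ (5 * k + 4) / ((t + 1 : ℕ) : ℝ) ≤ C₂ / ((t : ℝ) - 8) := by
      have hnum : (2 / min (p : ℝ) (1 - p)) ^ (5 * k + 4) ≤ C₂ := by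
        rw [hC₂, ← ha]; exact pow_le_pow_left₀ hlam0 hlam a
      calc (2 / min (p : ℝ) (1 - p)) ^ (5 * k + 4) / ((t + 1 : ℕ) : ℝ)
          ≤ C₂ / ((t + 1 : ℕ) : ℝ) := div_le_div_of_nonneg_right hnum (by positivity)
        _ ≤ C₂ / ((t : ℝ) - 8) := by
            apply div_le_div_of_nonneg_left hC₂0 (by linarith)
            push_cast; linarith
    calc _ ≤ _ := hmono
      _ ≤ _ := h2
      _ ≤ C₂ / ((t : ℝ) - 8) * P.real D.evGlued := by
          push_cast at hconst ⊢
          exact mul_le_mul_of_nonneg_right hconst measureReal_nonneg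
  exact H P D.evCol D.evGlued (fun ω => (D.Uent ω).ncard) (CircGlue.measurableSet_evCol D) hF1 hF2 hN

end NTW17

end Literature.Probability.Percolation

end
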